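import Summits.Ventures.CertifiedManyBodySolver.Upper.UMPSKernelTwins
import Summits.Ventures.CertifiedManyBodySolver.Upper.UMPSPolarCorrection
import HarnessLib

/-!
# uMPS dual certificates checked BY THE LEAN KERNEL, II: the Boolean check and its soundness

HONEST FRAMING: first certified bounds; not a superconductivity verdict; every number certified or
labelled float.

Venture `Ventures/CertifiedManyBodySolver` (sr-mbsolver), VAR's `var-umps-cert-v1` files with `ncell = 1`:
a dyadic tensor `A^s = Aint s / 2^a`, a dyadic symmetric `Z = Zint / 2^b`, a dyadic claim `q`. METHOD-umps
Theorem U1 + Lemma P (`hubbardChainEnergyDensity_le_of_umps_dual`, `polarTensor_dual_certificate`) turn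
the four facts

* `Σ_j |(Σ_s (Aint s)ᵀ Aint s − 4^a·1)_{ij}| ≤ epsN` for every row `i` (near-isometry, `ε = epsN/4^a`),
* `Zint` symmetric with row sums `≤ zN` (`z = zN/2^b`),
* `(γ·1 ∓ X) ⪰ 0` for the integer two-site matrix `X` (for `bondMatrix t U`: `γ = 4|t| + 3U/2`,
  `UMPSBondMatrixZ.lean`),
* `rN·1 − 2^{4a}·W(A; X, Z) ⪰ 0` over the INTEGERS (`2^{4a} W = dualMatrixZ`, `UMPSKernelTwins.lean`),
  certified by an untrusted integer Gram factor `G` and a shift `δ`: every row sum of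
  `|rN·1 − 2^{4a}W − δ·1 − GᵀG|` is `≤ δ` (`posSemidef_castC_of_gramShift`: rounded Cholesky factor +
  row-sum bound on the integer residual, the device of `Literature/LinearAlgebra/Matrix/GramCertificateCheck.lean`;
  Rump, Acta Numerica 19 (2010) §10.8),

into the exactly-isometric existential of the Venture's uMPS claim nodes
(`∃ A Z z, Σ AᴴA = 1 ∧ (c·1 − W(A;X,Z)) ⪰ 0 ∧ (z·1 ∓ Z) ⪰ 0`, witness `A := polarTensor (Aint/2^a)`) as soon as
`lemmaPSlack (epsN/4^a) γ (zN/2^b) ≤ c − rN/2^{4a}`. Everything asserted about the integer data is one closed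
Boolean `kernelCheck` — or, for a two-stage kernel evaluation that keeps each `decide +kernel` call within the
kernel's memory budget, `bondImageCheck` (the bond image `Y`) followed by `kernelCheckY` — meant to be evaluated
by `decide +kernel` on literal data (`Certificates/…_kernel.lean`); this file proves SOUNDNESS
(`umps_claim_of_kernelCheck`, `umps_claim_of_kernelCheckY`). 0 `sorry`, 0 new `def … : Prop`.
-/

noncomputable section

namespace Summit.Ventures.CertifiedManyBodySolver.Upper

open Matrix Finset Literature.MathematicalPhysics.QuantumLattice
open Literature.MathematicalPhysics.QuantumLattice.JordanWigner Literature.LinearAlgebra.Matrix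
open Literature.LinearAlgebra.Matrix.PolarOrthonormalization
open scoped ComplexOrder MatrixOrder Kronecker

/-! ### Positivity of an integer matrix from a rounded Gram factor and a shift -/

section Gram

variable {D : ℕ}

/-- Row sums of an integer matrix read in `ℂ`. -/
theorem sum_norm_castC (M : Matrix (Fin D) (Fin D) ℤ) (i : Fin D) :
    ∑ j, ‖castC M i j‖ = ∑ j, (|M i j| : ℝ) := by
  refine Finset.sum_congr rfl fun j _ => ?_
  rw [castC_apply, Complex.norm_intCast]

/-- `r·1` is Hermitian for real `r`. -/
theorem isHermitian_real_smul_one (r : ℝ) : ((r : ℂ) • (1 : Matrix (Fin D) (Fin D) ℂ)).IsHermitian := by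
  unfold Matrix.IsHermitian
  rw [conjTranspose_smul, conjTranspose_one, Complex.star_def, Complex.conj_ofReal]

/-- **Rounded-Cholesky certificate of positivity.** If `M` is a symmetric integer matrix, `G` any
integer matrix and `δ` a natural number such that every row sum of `|M − δ·1 − GᵀG|` is `≤ δ`, then
`M ⪰ 0` (read in `ℂ`): `M = GᵀG + (δ·1 + R)` with `R` Hermitian of row sums `≤ δ`, so `δ·1 + R ⪰ 0`
by the row-sum (Gershgorin) bound `neg_smul_one_le_of_rowSum_le`. (Rump, Acta Numerica 19 §10.8.) -/
theorem posSemidef_castC_of_gramShift {M G : Matrix (Fin D) (Fin D) ℤ} {δ : ℕ}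
    (hM : ∀ i j, M i j = M j i)
    (h : ∀ i, ∑ j, |(M - (δ : ℤ) • (1 : Matrix (Fin D) (Fin D) ℤ) - Gᵀ * G) i j| ≤ (δ : ℤ)) :
    (castC M).PosSemidef := by
  set R : Matrix (Fin D) (Fin D) ℤ := M - (δ : ℤ) • (1 : Matrix (Fin D) (Fin D) ℤ) - Gᵀ * G with hR
  have hdec : castC M = (castC G)ᴴ * castC G +
      (((δ : ℝ) : ℂ) • (1 : Matrix (Fin D) (Fin D) ℂ) + castC R) := by
    have hM' : M = Gᵀ * G + ((δ : ℤ) • (1 : Matrix (Fin D) (Fin D) ℤ) + R) := by rw [hR]; abel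
    rw [hM', map_add, map_add, map_mul, conjTranspose_castC, castC_smul, map_one]
    push_cast
    rfl
  have hRh : (castC R).IsHermitian := by
    have h1 : castC R = castC M - ((δ : ℝ) : ℂ) • (1 : Matrix (Fin D) (Fin D) ℂ) - (castC G)ᴴ * castC G := by
      rw [hR, map_sub, map_sub, map_mul, conjTranspose_castC, castC_smul, map_one]
      push_cast
      rfl
    rw [h1]
    exact ((castC_isHermitian hM).sub (isHermitian_real_smul_one _)).sub
      (isHermitian_conjTranspose_mul_self _)
  have hRrow : ∀ i, ∑ j, ‖castC R i j‖ ≤ (δ : ℝ) := by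
    intro i
    rw [sum_norm_castC]
    have := h i
    exact_mod_cast this
  have hRle := neg_smul_one_le_of_rowSum_le hRh hRrow
  have h2 : (((δ : ℝ) : ℂ) • (1 : Matrix (Fin D) (Fin D) ℂ) + castC R).PosSemidef := by
    have := Matrix.le_iff.mp hRle
    rwa [sub_neg_eq_add, add_comm] at this
  rw [hdec]
  exact (posSemidef_conjTranspose_mul_self _).add h2

end Gram

/-! ### The kernel check and its soundness -/

section Check

variable {q D : ℕ}

/-- METHOD-umps §3's Lemma-P slack as a function of `(ε, γ, z)`:
`(1 + 1/(1−ε)) (ε/(1−ε)) (1+ε) (γ(1+(1+ε)) + z)`. -/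
def lemmaPSlack (ε γ z : ℝ) : ℝ := (1 + 1 / (1 - ε)) * (ε / (1 - ε)) * (1 + ε) * (γ * (1 + (1 + ε)) + z)

/-- **The closed Boolean evaluated by the kernel.** For integer data `(Aint, Zint, X, G)`, dyadic
exponents `a, b` and integers `epsN, zN, δ, rN`:
(1) every row sum of `|Σ_s Aintₛᵀ Aintₛ − 4^a·1|` is `≤ epsN`; (2) `Zint` is symmetric; (3) its row
sums are `≤ zN`; (4) `X` is symmetric; (5) every row sum of `|rN·1 − W^ℤ − δ·1 − GᵀG|` is `≤ δ`
(`W^ℤ = dualMatrixZ Aint X Zint a b = 2^{4a}·W`). -/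
def kernelCheck (A : ZTensor q D) (Z : Matrix (Fin D) (Fin D) ℤ)
    (X : Matrix (Fin q × Fin q) (Fin q × Fin q) ℤ) (G : Matrix (Fin D) (Fin D) ℤ)
    (a b epsN zN δ : ℕ) (rN : ℤ) : Bool :=
  decide (∀ i, ∑ j, |(gramZ A - (2 ^ (2 * a) : ℤ) • (1 : Matrix (Fin D) (Fin D) ℤ)) i j| ≤ (epsN : ℤ)) &&
  decide (∀ i j, Z i j = Z j i) &&
  decide (∀ i, ∑ j, |Z i j| ≤ (zN : ℤ)) &&
  decide (∀ p p', X p p' = X p' p) &&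
  decide (∀ i, ∑ j, |((rN • (1 : Matrix (Fin D) (Fin D) ℤ) - dualMatrixZ A X Z a b) -
    (δ : ℤ) • (1 : Matrix (Fin D) (Fin D) ℤ) - Gᵀ * G) i j| ≤ (δ : ℤ))

/-- **Stage A of a two-stage kernel evaluation**: a supplied integer matrix `Y` IS the bond image
`Y^ℤ_X(Aint)` (checked entrywise; the bond image is the expensive part, so large instances evaluate it in
its own kernel call and feed the literal `Y` to `kernelCheckY`). -/
def bondImageCheck (A : ZTensor q D) (X : Matrix (Fin q × Fin q) (Fin q × Fin q) ℤ)
    (Y : Matrix (Fin D) (Fin D) ℤ) : Bool :=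
  decide (∀ i j, bondImageZ A X i j = Y i j)

/-- A passing `bondImageCheck` identifies `Y` with the integer bond image. -/
theorem bondImageZ_eq_of_check {A : ZTensor q D} {X : Matrix (Fin q × Fin q) (Fin q × Fin q) ℤ}
    {Y : Matrix (Fin D) (Fin D) ℤ} (h : bondImageCheck A X Y = true) : bondImageZ A X = Y := by
  unfold bondImageCheck at h
  ext i j
  exact of_decide_eq_true h i j

/-- **Stage B**: `kernelCheck` with the bond image supplied as a literal `Y` (see `bondImageCheck`). -/
def kernelCheckY (A : ZTensor q D) (Z : Matrix (Fin D) (Fin D) ℤ)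
    (X : Matrix (Fin q × Fin q) (Fin q × Fin q) ℤ) (G Y : Matrix (Fin D) (Fin D) ℤ)
    (a b epsN zN δ : ℕ) (rN : ℤ) : Bool :=
  decide (∀ i, ∑ j, |(gramZ A - (2 ^ (2 * a) : ℤ) • (1 : Matrix (Fin D) (Fin D) ℤ)) i j| ≤ (epsN : ℤ)) &&
  decide (∀ i j, Z i j = Z j i) &&
  decide (∀ i, ∑ j, |Z i j| ≤ (zN : ℤ)) &&
  decide (∀ p p', X p p' = X p' p) &&
  decide (∀ i, ∑ j, |((rN • (1 : Matrix (Fin D) (Fin D) ℤ) -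
    (Y + (2 ^ (2 * a - b) : ℤ) • heisenbergZ A Z - (2 ^ (4 * a - b) : ℤ) • Z)) -
    (δ : ℤ) • (1 : Matrix (Fin D) (Fin D) ℤ) - Gᵀ * G) i j| ≤ (δ : ℤ))

/-- Stage P (one call per `p`): a supplied integer matrix `P p` IS the two-site product `Aint p₁ · Aint p₂`. -/
def prodCheckAt (A : ZTensor q D) (P : Fin q × Fin q → Matrix (Fin D) (Fin D) ℤ) (p : Fin q × Fin q) : Bool :=
  decide (∀ i j, (A p.1 * A p.2) i j = P p i j)

/-- Stage Y (one call per row `i`): `(Σ_p (P p)ᵀ (Σ_p' X_pp' P p'))_{ij} = Y_{ij}` from literal products `P`. -/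
def bondImageRowCheck (P : Fin q × Fin q → Matrix (Fin D) (Fin D) ℤ)
    (X : Matrix (Fin q × Fin q) (Fin q × Fin q) ℤ) (Y : Matrix (Fin D) (Fin D) ℤ) (i : Fin D) : Bool :=
  decide (∀ j, (∑ p : Fin q × Fin q, (P p)ᵀ * ∑ p' : Fin q × Fin q, X p p' • P p') i j = Y i j)

/-- Stages P + Y identify `Y` with the integer bond image. -/
theorem bondImageZ_eq_of_rowChecks {A : ZTensor q D} {P : Fin q × Fin q → Matrix (Fin D) (Fin D) ℤ}
    {X : Matrix (Fin q × Fin q) (Fin q × Fin q) ℤ} {Y : Matrix (Fin D) (Fin D) ℤ}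
    (hP : ∀ p, prodCheckAt A P p = true) (hY : ∀ i, bondImageRowCheck P X Y i = true) :
    bondImageZ A X = Y := by
  have hP' : ∀ p : Fin q × Fin q, A p.1 * A p.2 = P p := fun p => by
    ext i j; exact of_decide_eq_true (hP p) i j
  have hb : bondImageZ A X = ∑ p : Fin q × Fin q, (P p)ᵀ * ∑ p' : Fin q × Fin q, X p p' • P p' := by
    unfold bondImageZ
    simp only [hP']
  ext i j
  rw [hb]
  exact of_decide_eq_true (hY i) j

/-- Stage Q (one call per `p`): a supplied `Q p` IS the combination `Σ_p' X_pp' P p'` of the literal products. -/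
def combCheckAt (P Q : Fin q × Fin q → Matrix (Fin D) (Fin D) ℤ) (X : Matrix (Fin q × Fin q) (Fin q × Fin q) ℤ)
    (p : Fin q × Fin q) : Bool :=
  decide (∀ i j, (∑ p' : Fin q × Fin q, X p p' • P p') i j = Q p i j)

/-- Stage Y from literal `P` and `Q` (one call per row `i`): `(Σ_p (P p)ᵀ (Q p))_{ij} = Y_{ij}`. -/
def bondImageRowCheckQ (P Q : Fin q × Fin q → Matrix (Fin D) (Fin D) ℤ) (Y : Matrix (Fin D) (Fin D) ℤ)
    (i : Fin D) : Bool :=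
  decide (∀ j, (∑ p : Fin q × Fin q, (P p)ᵀ * Q p) i j = Y i j)

/-- Stages P + Q + Y identify `Y` with the integer bond image. -/
theorem bondImageZ_eq_of_rowChecksQ {A : ZTensor q D} {P Q : Fin q × Fin q → Matrix (Fin D) (Fin D) ℤ}
    {X : Matrix (Fin q × Fin q) (Fin q × Fin q) ℤ} {Y : Matrix (Fin D) (Fin D) ℤ}
    (hP : ∀ p, prodCheckAt A P p = true) (hQ : ∀ p, combCheckAt P Q X p = true)
    (hY : ∀ i, bondImageRowCheckQ P Q Y i = true) : bondImageZ A X = Y := by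
  have hP' : ∀ p : Fin q × Fin q, A p.1 * A p.2 = P p := fun p => by
    ext i j; exact of_decide_eq_true (hP p) i j
  have hQ' : ∀ p : Fin q × Fin q, (∑ p' : Fin q × Fin q, X p p' • P p') = Q p := fun p => by
    ext i j; exact of_decide_eq_true (hQ p) i j
  have hb : bondImageZ A X = ∑ p : Fin q × Fin q, (P p)ᵀ * Q p := by
    unfold bondImageZ
    simp only [hP', hQ']
  ext i j
  rw [hb]
  exact of_decide_eq_true (hY i) j

/-- Stage Φ (one call per row `i`): row `i` of a supplied `Φ` IS row `i` of `Σ_s (Aint s)ᵀ Zint (Aint s)`. -/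
def heisenbergRowCheck (A : ZTensor q D) (Z F : Matrix (Fin D) (Fin D) ℤ) (i : Fin D) : Bool :=
  decide (∀ j, (∑ s, (A s)ᵀ * (Z * A s)) i j = F i j)

/-- Stage Φ identifies `F` with the integer Heisenberg image. -/
theorem heisenbergZ_eq_of_rowChecks {A : ZTensor q D} {Z F : Matrix (Fin D) (Fin D) ℤ}
    (h : ∀ i, heisenbergRowCheck A Z F i = true) : heisenbergZ A Z = F := by
  ext i j
  exact of_decide_eq_true (h i) j

/-- Check (1) alone: near-isometry row sums of the integer Gram matrix. -/
def gramCheck (A : ZTensor q D) (a epsN : ℕ) : Bool :=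
  decide (∀ i, ∑ j, |(gramZ A - (2 ^ (2 * a) : ℤ) • (1 : Matrix (Fin D) (Fin D) ℤ)) i j| ≤ (epsN : ℤ))

/-- Checks (2)–(4): `Zint` symmetric with row sums `≤ zN`, `X` symmetric. -/
def symmCheck (Z : Matrix (Fin D) (Fin D) ℤ) (zN : ℕ) (X : Matrix (Fin q × Fin q) (Fin q × Fin q) ℤ) : Bool :=
  decide (∀ i j, Z i j = Z j i) && decide (∀ i, ∑ j, |Z i j| ≤ (zN : ℤ)) && decide (∀ p p', X p p' = X p' p)

/-- Check (5) from literal `Y`, `F`: every row sum of `|rN·1 − (Y + 2^{2a−b} F − 2^{4a−b} Zint) − δ·1 − GᵀG|` is `≤ δ`. -/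
def residualCheck (Y F Z G : Matrix (Fin D) (Fin D) ℤ) (a b δ : ℕ) (rN : ℤ) : Bool :=
  decide (∀ i, ∑ j, |((rN • (1 : Matrix (Fin D) (Fin D) ℤ) -
    (Y + (2 ^ (2 * a - b) : ℤ) • F - (2 ^ (4 * a - b) : ℤ) • Z)) -
    (δ : ℤ) • (1 : Matrix (Fin D) (Fin D) ℤ) - Gᵀ * G) i j| ≤ (δ : ℤ))

/-- Near-isometry of the dyadic tensor from check (1): `Σ_j ‖(gram A − 1)_{ij}‖ ≤ epsN / 4^a`. -/
theorem gram_rowSum_of_check (A : ZTensor q D) {a epsN : ℕ}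
    (h : ∀ i, ∑ j, |(gramZ A - (2 ^ (2 * a) : ℤ) • (1 : Matrix (Fin D) (Fin D) ℤ)) i j| ≤ (epsN : ℤ))
    (i : Fin D) : ∑ j, ‖(gram (dyadicTensor A a) - 1) i j‖ ≤ (epsN : ℝ) / 2 ^ (2 * a) := by
  have hc : dy a * dy a = (((((2 : ℝ) ^ (2 * a))⁻¹ : ℝ)) : ℂ) := by
    rw [dy]; push_cast; ring
  have hone : gram (dyadicTensor A a) - 1 =
      (((((2 : ℝ) ^ (2 * a))⁻¹ : ℝ)) : ℂ) • castC (gramZ A - (2 ^ (2 * a) : ℤ) • (1 : Matrix (Fin D) (Fin D) ℤ)) := by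
    rw [gram_dyadicTensor, hc, map_sub, castC_smul, map_one, smul_sub, smul_smul]
    congr 1
    have : ((((2 : ℝ) ^ (2 * a))⁻¹ : ℝ) : ℂ) * ((2 ^ (2 * a) : ℤ) : ℂ) = 1 := by
      push_cast
      exact inv_mul_cancel₀ (pow_ne_zero _ two_ne_zero)
    rw [this, one_smul]
  rw [hone, sum_norm_smul_castC, abs_of_pos (by positivity), div_eq_inv_mul]
  refine mul_le_mul_of_nonneg_left ?_ (by positivity)
  have := h i
  exact_mod_cast this

/-- The dyadic `Z` is Hermitian when `Zint` is symmetric (check (2)). -/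
theorem dyadicMatrix_isHermitian {Z : Matrix (Fin D) (Fin D) ℤ} (hZ : ∀ i j, Z i j = Z j i) (b : ℕ) :
    (dyadicMatrix Z b).IsHermitian := by
  unfold dyadicMatrix Matrix.IsHermitian
  rw [conjTranspose_smul, star_dy, (castC_isHermitian hZ).eq]

/-- Row sums of the dyadic `Z` from check (3): `Σ_j ‖Z_{ij}‖ ≤ zN / 2^b`. -/
theorem dyadicMatrix_rowSum_of_check {Z : Matrix (Fin D) (Fin D) ℤ} {b zN : ℕ}
    (h : ∀ i, ∑ j, |Z i j| ≤ (zN : ℤ)) (i : Fin D) :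
    ∑ j, ‖dyadicMatrix Z b i j‖ ≤ (zN : ℝ) / 2 ^ b := by
  unfold dyadicMatrix
  rw [dy, sum_norm_smul_castC, abs_of_pos (by positivity), div_eq_inv_mul]
  refine mul_le_mul_of_nonneg_left ?_ (by positivity)
  have := h i
  exact_mod_cast this

/-- The dual certificate from checks (2), (4), (5):
`((rN / 2^{4a})·1 − W(Aint/2^a; X, Zint/2^b)) ⪰ 0`. -/
theorem posSemidef_dual_of_check (A : ZTensor q D) {Z G : Matrix (Fin D) (Fin D) ℤ}
    {X : Matrix (Fin q × Fin q) (Fin q × Fin q) ℤ} {a b δ : ℕ} {rN : ℤ} (hb : b ≤ 2 * a)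
    (hZ : ∀ i j, Z i j = Z j i) (hX : ∀ p p', X p p' = X p' p)
    (h : ∀ i, ∑ j, |((rN • (1 : Matrix (Fin D) (Fin D) ℤ) - dualMatrixZ A X Z a b) -
      (δ : ℤ) • (1 : Matrix (Fin D) (Fin D) ℤ) - Gᵀ * G) i j| ≤ (δ : ℤ)) :
    (((((rN : ℝ) / 2 ^ (4 * a) : ℝ)) : ℂ) • (1 : Matrix (Fin D) (Fin D) ℂ) -
      dualMatrix (dyadicTensor A a) (castC X) (dyadicMatrix Z b)).PosSemidef := by
  have hMsym : ∀ i j, (rN • (1 : Matrix (Fin D) (Fin D) ℤ) - dualMatrixZ A X Z a b) i j =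
      (rN • (1 : Matrix (Fin D) (Fin D) ℤ) - dualMatrixZ A X Z a b) j i := by
    intro i j
    rw [Matrix.sub_apply, Matrix.sub_apply, dualMatrixZ_symm A hX hZ a b i j, Matrix.smul_apply,
      Matrix.smul_apply, one_apply, one_apply]
    by_cases hij : i = j
    · subst hij; rfl
    · rw [if_neg hij, if_neg (Ne.symm hij)]
  have hpsd := posSemidef_castC_of_gramShift hMsym h
  rw [map_sub, castC_smul, map_one, castC_dualMatrixZ A X Z hb] at hpsd
  have hc : (0 : ℂ) ≤ ((((2 : ℝ) ^ (4 * a))⁻¹ : ℝ) : ℂ) := Complex.zero_le_real.2 (by positivity)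
  have key := hpsd.smul hc
  have e1 : ((((2 : ℝ) ^ (4 * a))⁻¹ : ℝ) : ℂ) * ((rN : ℤ) : ℂ) = ((((rN : ℝ) / 2 ^ (4 * a) : ℝ)) : ℂ) := by
    push_cast; ring
  have e2 : ((((2 : ℝ) ^ (4 * a))⁻¹ : ℝ) : ℂ) * ((2 : ℂ) ^ (4 * a)) = 1 := by
    push_cast
    exact inv_mul_cancel₀ (pow_ne_zero _ two_ne_zero)
  rwa [smul_sub, smul_smul, smul_smul, e1, e2, one_smul] at key

/-- Soundness core: the five checked facts (as propositions) imply the claim. -/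
theorem umps_claim_of_checks (A : ZTensor q D) (Z G : Matrix (Fin D) (Fin D) ℤ)
    (X : Matrix (Fin q × Fin q) (Fin q × Fin q) ℤ) {a b epsN zN δ : ℕ} {rN : ℤ} (hb : b ≤ 2 * a)
    (h1 : ∀ i, ∑ j, |(gramZ A - (2 ^ (2 * a) : ℤ) • (1 : Matrix (Fin D) (Fin D) ℤ)) i j| ≤ (epsN : ℤ))
    (h2 : ∀ i j, Z i j = Z j i) (h3 : ∀ i, ∑ j, |Z i j| ≤ (zN : ℤ)) (h4 : ∀ p p', X p p' = X p' p)
    (h5 : ∀ i, ∑ j, |((rN • (1 : Matrix (Fin D) (Fin D) ℤ) - dualMatrixZ A X Z a b) -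
      (δ : ℤ) • (1 : Matrix (Fin D) (Fin D) ℤ) - Gᵀ * G) i j| ≤ (δ : ℤ))
    {γ : ℝ} (hγ : 0 ≤ γ)
    (hX₁ : ((γ : ℂ) • (1 : Matrix (Fin q × Fin q) (Fin q × Fin q) ℂ) - castC X).PosSemidef)
    (hX₂ : ((γ : ℂ) • (1 : Matrix (Fin q × Fin q) (Fin q × Fin q) ℂ) + castC X).PosSemidef)
    {c η : ℝ} (hε1 : (epsN : ℝ) / 2 ^ (2 * a) < 1)
    (hη : lemmaPSlack ((epsN : ℝ) / 2 ^ (2 * a)) γ ((zN : ℝ) / 2 ^ b) ≤ η)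
    (hc : c - η = (rN : ℝ) / 2 ^ (4 * a)) :
    ∃ (A' : MPSTensor q D) (Z' : Matrix (Fin D) (Fin D) ℂ) (z : ℝ), (∑ s, (A' s)ᴴ * A' s = 1) ∧
      (((c : ℂ)) • (1 : Matrix (Fin D) (Fin D) ℂ) - dualMatrix A' (castC X) Z').PosSemidef ∧
      (((z : ℂ) • (1 : Matrix (Fin D) (Fin D) ℂ) - Z').PosSemidef) ∧
      (((z : ℂ) • (1 : Matrix (Fin D) (Fin D) ℂ) + Z').PosSemidef) := by
  have hε0 : (0 : ℝ) ≤ (epsN : ℝ) / 2 ^ (2 * a) := by positivity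
  have hz : (0 : ℝ) ≤ (zN : ℝ) / 2 ^ b := by positivity
  have hG := gram_rowSum_of_check A h1
  have hZh := dyadicMatrix_isHermitian h2 b
  have hZr := dyadicMatrix_rowSum_of_check (b := b) h3
  have hZ₁ : (((((zN : ℝ) / 2 ^ b : ℝ)) : ℂ) • (1 : Matrix (Fin D) (Fin D) ℂ) - dyadicMatrix Z b).PosSemidef :=
    Matrix.le_iff.mp (le_smul_one_of_rowSum_le hZh hZr)
  have hZ₂ : (((((zN : ℝ) / 2 ^ b : ℝ)) : ℂ) • (1 : Matrix (Fin D) (Fin D) ℂ) + dyadicMatrix Z b).PosSemidef := by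
    have h := Matrix.le_iff.mp (neg_smul_one_le_of_rowSum_le hZh hZr)
    rwa [sub_neg_eq_add, add_comm] at h
  have hW := posSemidef_dual_of_check A hb h2 h4 h5
  rw [← hc] at hW
  obtain ⟨hiso, hdual⟩ := polarTensor_dual_certificate hε0 hε1 hγ hz hG hX₁ hX₂ hZ₁ hZ₂ hη hW
  exact ⟨polarTensor (dyadicTensor A a), dyadicMatrix Z b, (zN : ℝ) / 2 ^ b, hiso, hdual, hZ₁, hZ₂⟩

/-- **Soundness of the kernel check.** If `kernelCheck Aint Zint X G a b epsN zN δ rN` passes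
(`b ≤ 2a`, `epsN < 4^a`), the two-site matrix `castC X` satisfies `(γ·1 ∓ X) ⪰ 0`, and the claim `c`
exceeds `rN/2^{4a}` by at least the Lemma-P slack `lemmaPSlack (epsN/4^a) γ (zN/2^b)`, then the
exactly-isometric tensor `Ã = polarTensor (Aint/2^a)` and `Z = Zint/2^b`, `z = zN/2^b` witness the
Venture's uMPS claim node: `Σ ÃᴴÃ = 1`, `(c·1 − W(Ã; X, Z)) ⪰ 0`, `(z·1 ∓ Z) ⪰ 0`
(METHOD-umps Theorem U1 + Lemma P; `polarTensor_dual_certificate`). -/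
theorem umps_claim_of_kernelCheck (A : ZTensor q D) (Z G : Matrix (Fin D) (Fin D) ℤ)
    (X : Matrix (Fin q × Fin q) (Fin q × Fin q) ℤ) {a b epsN zN δ : ℕ} {rN : ℤ} (hb : b ≤ 2 * a)
    (hcheck : kernelCheck A Z X G a b epsN zN δ rN = true)
    {γ : ℝ} (hγ : 0 ≤ γ)
    (hX₁ : ((γ : ℂ) • (1 : Matrix (Fin q × Fin q) (Fin q × Fin q) ℂ) - castC X).PosSemidef)
    (hX₂ : ((γ : ℂ) • (1 : Matrix (Fin q × Fin q) (Fin q × Fin q) ℂ) + castC X).PosSemidef)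
    {c η : ℝ} (hε1 : (epsN : ℝ) / 2 ^ (2 * a) < 1)
    (hη : lemmaPSlack ((epsN : ℝ) / 2 ^ (2 * a)) γ ((zN : ℝ) / 2 ^ b) ≤ η)
    (hc : c - η = (rN : ℝ) / 2 ^ (4 * a)) :
    ∃ (A' : MPSTensor q D) (Z' : Matrix (Fin D) (Fin D) ℂ) (z : ℝ), (∑ s, (A' s)ᴴ * A' s = 1) ∧
      (((c : ℂ)) • (1 : Matrix (Fin D) (Fin D) ℂ) - dualMatrix A' (castC X) Z').PosSemidef ∧
      (((z : ℂ) • (1 : Matrix (Fin D) (Fin D) ℂ) - Z').PosSemidef) ∧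
      (((z : ℂ) • (1 : Matrix (Fin D) (Fin D) ℂ) + Z').PosSemidef) := by
  simp only [kernelCheck, Bool.and_eq_true, decide_eq_true_eq] at hcheck
  obtain ⟨⟨⟨⟨h1, h2⟩, h3⟩, h4⟩, h5⟩ := hcheck
  exact umps_claim_of_checks A Z G X hb h1 h2 h3 h4 h5 hγ hX₁ hX₂ hε1 hη hc

/-- **Soundness, two-stage form** (`bondImageCheck` + `kernelCheckY`): as `umps_claim_of_kernelCheck`,
with the bond image evaluated in a separate kernel call and supplied to the residual check as `Y`. -/
theorem umps_claim_of_kernelCheckY (A : ZTensor q D) (Z G Y : Matrix (Fin D) (Fin D) ℤ)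
    (X : Matrix (Fin q × Fin q) (Fin q × Fin q) ℤ) {a b epsN zN δ : ℕ} {rN : ℤ} (hb : b ≤ 2 * a)
    (hY : bondImageCheck A X Y = true)
    (hcheck : kernelCheckY A Z X G Y a b epsN zN δ rN = true)
    {γ : ℝ} (hγ : 0 ≤ γ)
    (hX₁ : ((γ : ℂ) • (1 : Matrix (Fin q × Fin q) (Fin q × Fin q) ℂ) - castC X).PosSemidef)
    (hX₂ : ((γ : ℂ) • (1 : Matrix (Fin q × Fin q) (Fin q × Fin q) ℂ) + castC X).PosSemidef)
    {c η : ℝ} (hε1 : (epsN : ℝ) / 2 ^ (2 * a) < 1)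
    (hη : lemmaPSlack ((epsN : ℝ) / 2 ^ (2 * a)) γ ((zN : ℝ) / 2 ^ b) ≤ η)
    (hc : c - η = (rN : ℝ) / 2 ^ (4 * a)) :
    ∃ (A' : MPSTensor q D) (Z' : Matrix (Fin D) (Fin D) ℂ) (z : ℝ), (∑ s, (A' s)ᴴ * A' s = 1) ∧
      (((c : ℂ)) • (1 : Matrix (Fin D) (Fin D) ℂ) - dualMatrix A' (castC X) Z').PosSemidef ∧
      (((z : ℂ) • (1 : Matrix (Fin D) (Fin D) ℂ) - Z').PosSemidef) ∧
      (((z : ℂ) • (1 : Matrix (Fin D) (Fin D) ℂ) + Z').PosSemidef) := by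
  simp only [kernelCheckY, Bool.and_eq_true, decide_eq_true_eq] at hcheck
  obtain ⟨⟨⟨⟨h1, h2⟩, h3⟩, h4⟩, h5⟩ := hcheck
  have hY' := bondImageZ_eq_of_check hY
  have h5' : ∀ i, ∑ j, |((rN • (1 : Matrix (Fin D) (Fin D) ℤ) - dualMatrixZ A X Z a b) -
      (δ : ℤ) • (1 : Matrix (Fin D) (Fin D) ℤ) - Gᵀ * G) i j| ≤ (δ : ℤ) := by
    rw [dualMatrixZ, hY']
    exact h5
  exact umps_claim_of_checks A Z G X hb h1 h2 h3 h4 h5' hγ hX₁ hX₂ hε1 hη hc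

/-- **Soundness, finely staged form**: the bond image `Y` and the Heisenberg image `F` are identified by
row-wise kernel calls (`prodCheckAt`, `bondImageRowCheck`, `heisenbergRowCheck`), the remaining checks are
`gramCheck`, `symmCheck`, `residualCheck`; conclusion as in `umps_claim_of_kernelCheck`. -/
theorem umps_claim_of_stagedChecks (A : ZTensor q D) (Z G Y F : Matrix (Fin D) (Fin D) ℤ)
    (X : Matrix (Fin q × Fin q) (Fin q × Fin q) ℤ) {a b epsN zN δ : ℕ} {rN : ℤ} (hb : b ≤ 2 * a)
    (hY : bondImageZ A X = Y) (hF : heisenbergZ A Z = F)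
    (hg : gramCheck A a epsN = true) (hs : symmCheck Z zN X = true)
    (hr : residualCheck Y F Z G a b δ rN = true)
    {γ : ℝ} (hγ : 0 ≤ γ)
    (hX₁ : ((γ : ℂ) • (1 : Matrix (Fin q × Fin q) (Fin q × Fin q) ℂ) - castC X).PosSemidef)
    (hX₂ : ((γ : ℂ) • (1 : Matrix (Fin q × Fin q) (Fin q × Fin q) ℂ) + castC X).PosSemidef)
    {c η : ℝ} (hε1 : (epsN : ℝ) / 2 ^ (2 * a) < 1)
    (hη : lemmaPSlack ((epsN : ℝ) / 2 ^ (2 * a)) γ ((zN : ℝ) / 2 ^ b) ≤ η)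
    (hc : c - η = (rN : ℝ) / 2 ^ (4 * a)) :
    ∃ (A' : MPSTensor q D) (Z' : Matrix (Fin D) (Fin D) ℂ) (z : ℝ), (∑ s, (A' s)ᴴ * A' s = 1) ∧
      (((c : ℂ)) • (1 : Matrix (Fin D) (Fin D) ℂ) - dualMatrix A' (castC X) Z').PosSemidef ∧
      (((z : ℂ) • (1 : Matrix (Fin D) (Fin D) ℂ) - Z').PosSemidef) ∧
      (((z : ℂ) • (1 : Matrix (Fin D) (Fin D) ℂ) + Z').PosSemidef) := by
  unfold gramCheck at hg
  simp only [symmCheck, Bool.and_eq_true, decide_eq_true_eq] at hs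
  obtain ⟨⟨h2, h3⟩, h4⟩ := hs
  unfold residualCheck at hr
  have h1 := of_decide_eq_true hg
  have h5 := of_decide_eq_true hr
  have h5' : ∀ i, ∑ j, |((rN • (1 : Matrix (Fin D) (Fin D) ℤ) - dualMatrixZ A X Z a b) -
      (δ : ℤ) • (1 : Matrix (Fin D) (Fin D) ℤ) - Gᵀ * G) i j| ≤ (δ : ℤ) := by
    rw [dualMatrixZ, hY, hF]
    exact h5
  exact umps_claim_of_checks A Z G X hb h1 h2 h3 h4 h5' hγ hX₁ hX₂ hε1 hη hc

end Check

end Summit.Ventures.CertifiedManyBodySolver.Upper
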